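import Literature.InformationTheory.QuantumCodes.ToricCodeMinWeight
import Literature.InformationTheory.QuantumCodes.MinWeightDecodingClusters
import HarnessLib

/-!
# Toric-code clusters: restriction of chains, the cut lemma, connected non-bounding pieces, and the
# degree of the toric check graph (inputs of the cluster-counting threshold route)

Venture QEC, `Summits/Ventures/QEC/Thresholds/` (LADDER-QEC Q5). HONEST FRAMING: a SECOND, independent
route to a certified toric-code threshold under minimum-weight decoding and independent bit flips —
the Kovalev–Pryadko / Gottesman cluster-counting bound (`ClusterCountingBound.lean`, generic in the
qubit index type) instead of Dennis et al.'s self-avoiding-polygon count. Its constant is tiny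
(`p₀ = (2Δ²)⁻² = 1/5184` for the toric check graph of degree `Δ = 6`, vs. `≈ .029–.036` for the DKLP
route of `ToricCodeThresholds.lean`), but its ONLY unproved input is the toric distance statement
`ToricCode.cycle_weight_ge` ("a homologically non-trivial cycle has `≥ L` links", DKLP §5.2; named
fact of `ToricCodeThreshold.lean`, taken as the hypothesis `hL`) — it does NOT need the polygon
extraction and the walk-count lifting of the DKLP route. THIS FILE (all PROVED, kernel axioms, no fact used): the restriction API for chains
(`Chain.restrict` of `ToricCodeMinWeight.lean`), the cut lemma `syn_restrict_eq_zero` ("different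
clusters affect disjoint sets of stabilizer generators"), the connected non-bounding piece
`exists_connected_piece` (port of the Fin-indexed `MinWeightDecodingClusters.exists_connected_piece`
to the torus-indexed chains), and the degree bound `degree_starGraph_le` (`Δ ≤ 2·(4-1) = 6`: each
link carries 2 stars of 4 links each; row weight `≤ 4`, column weight `≤ 2`). The companion
`ToricCodeClusterThreshold.lean` assembles them with `cycle_weight_ge` into the threshold
`1/(4·6⁴) = 1/5184`. No Monte Carlo number here.

## References

* [DennisEtAl2002] Dennis–Kitaev–Landahl–Preskill, J. Math. Phys. 43 (2002) 4452, §5.2.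
* [Gottesman2014] D. Gottesman, Quantum Inf. Comput. 14 (2014) 1338, §4 Thm. 3 (cluster argument).
* [KovalevPryadko2013] A. A. Kovalev, L. P. Pryadko, Phys. Rev. A 87 (2013) 020304(R), Thm. 3.
-/

noncomputable section

namespace Summit.Ventures.QEC.Thresholds

open Filter Topology Finset Matrix
open Literature.InformationTheory.QuantumCodes
open Literature.InformationTheory.QuantumCodes.ToricCode
open Literature.Probability.LatticeModels

namespace ToricCluster

variable {L : ℕ}

/-! ### Restriction of chains (API) -/

/-- `z|_A` agrees with `z` on `A`. [folklore] -/
theorem restrict_apply_of_mem {A : Finset (Edge L)} {z : Chain L} {ℓ : Edge L} (h : ℓ ∈ A) :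
    Chain.restrict A z ℓ = z ℓ := by
  simp [Chain.restrict, h]

/-- `z|_A` vanishes off `A`. [folklore] -/
theorem restrict_apply_of_not_mem {A : Finset (Edge L)} {z : Chain L} {ℓ : Edge L} (h : ℓ ∉ A) :
    Chain.restrict A z ℓ = 0 := by
  simp [Chain.restrict, h]

/-- `z|_A + z|_{Aᶜ} = z`. [folklore] -/
theorem restrict_add_restrict_compl [NeZero L] (A : Finset (Edge L)) (z : Chain L) :
    Chain.restrict A z + Chain.restrict Aᶜ z = z := by
  funext ℓ
  by_cases h : ℓ ∈ A
  · simp [Chain.restrict, h]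
  · have : ℓ ∈ Aᶜ := Finset.mem_compl.2 h
    simp [Chain.restrict, h]

/-- `supp (z|_A) = A` when `A ⊆ supp z`. [folklore] -/
theorem supp_restrict_of_subset [NeZero L] {z : Chain L} {A : Finset (Edge L)} (hA : A ⊆ supp z) :
    supp (Chain.restrict A z) = A := by
  ext ℓ
  simp only [supp, Finset.mem_filter, Finset.mem_univ, true_and]
  by_cases h : ℓ ∈ A
  · rw [restrict_apply_of_mem h]
    have := hA h
    simp only [supp, Finset.mem_filter, Finset.mem_univ, true_and] at this
    exact ⟨fun _ => h, fun _ => this⟩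
  · rw [restrict_apply_of_not_mem h]
    simp [h]

/-- `supp (z|_{Aᶜ}) = supp z ∖ A`. [folklore] -/
theorem supp_restrict_compl [NeZero L] (z : Chain L) (A : Finset (Edge L)) :
    supp (Chain.restrict Aᶜ z) = supp z \ A := by
  ext ℓ
  simp only [supp, Finset.mem_filter, Finset.mem_univ, true_and, Finset.mem_sdiff]
  by_cases h : ℓ ∈ A
  · have : ℓ ∉ Aᶜ := fun h' => Finset.mem_compl.1 h' h
    rw [restrict_apply_of_not_mem this]
    simp [h]
  · rw [restrict_apply_of_mem (Finset.mem_compl.2 h)]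
    simp [h]

/-- Restricting twice along `A ⊆ B` is restricting to `A`. [folklore] -/
theorem restrict_restrict_of_subset (z : Chain L) {A B : Finset (Edge L)} (hAB : A ⊆ B) :
    Chain.restrict A (Chain.restrict B z) = Chain.restrict A z := by
  funext ℓ
  by_cases h : ℓ ∈ A
  · rw [restrict_apply_of_mem h, restrict_apply_of_mem h, restrict_apply_of_mem (hAB h)]
  · rw [restrict_apply_of_not_mem h, restrict_apply_of_not_mem h]

/-- Restricting to the support changes nothing. [folklore] -/
theorem restrict_supp_self [NeZero L] (z : Chain L) : Chain.restrict (supp z) z = z := by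
  funext ℓ
  by_cases h : ℓ ∈ supp z
  · rw [restrict_apply_of_mem h]
  · rw [restrict_apply_of_not_mem h]
    simp only [supp, Finset.mem_filter, Finset.mem_univ, true_and, not_not] at h
    exact h.symm

/-- The weight of `z|_A` is `|A|` when `A ⊆ supp z`. [folklore] -/
theorem hammingNorm_restrict_of_subset [NeZero L] {z : Chain L} {A : Finset (Edge L)}
    (hA : A ⊆ supp z) : hammingNorm (Chain.restrict A z) = A.card := by
  rw [show hammingNorm (Chain.restrict A z) = (supp (Chain.restrict A z)).card from rfl,
    supp_restrict_of_subset hA]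

/-! ### The cut lemma: stars do not see across a cut of the check graph -/

/-- **Cut lemma** ("different clusters affect disjoint sets of stabilizer generators"): if `z` is a
cycle and no star meets both `A` and `supp z ∖ A`, then `z|_A` is a cycle.
[cite: KovalevPryadko2013, §II] -/
theorem syn_restrict_eq_zero [NeZero L] {z : Chain L} (hz : syn L z = 0) {A : Finset (Edge L)}
    (hcut : ∀ a ∈ A, z a ≠ 0 → ∀ b ∈ supp z \ A, ¬ (checkGraph (starMatrix L)).Adj a b) :
    syn L (Chain.restrict A z) = 0 := by
  classical
  funext r
  have hzr : ∑ v, starMatrix L r v * z v = 0 := by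
    have := congrFun hz r
    simpa [syn, mulVec, dotProduct] using this
  show (starMatrix L *ᵥ Chain.restrict A z) r = 0
  simp only [mulVec, dotProduct]
  by_cases hex : ∃ a ∈ A, starMatrix L r a ≠ 0 ∧ z a ≠ 0
  · obtain ⟨a, haA, hHa, hza⟩ := hex
    have heq : ∑ v, starMatrix L r v * z v = ∑ v, starMatrix L r v * Chain.restrict A z v := by
      refine Finset.sum_congr rfl fun v _ => ?_
      by_cases hv : v ∈ A
      · rw [restrict_apply_of_mem hv]
      · rw [restrict_apply_of_not_mem hv, mul_zero]
        by_cases hzv : z v = 0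
        · rw [hzv, mul_zero]
        · have hb : v ∈ supp z \ A := by
            refine Finset.mem_sdiff.2 ⟨?_, hv⟩
            simpa [supp] using hzv
          have hav : a ≠ v := fun h => hv (h ▸ haA)
          have hHv : starMatrix L r v = 0 := by
            by_contra hHv
            exact hcut a haA hza v hb ⟨hav, r, hHa, hHv⟩
          rw [hHv, zero_mul]
    rw [← heq]
    exact hzr
  · push Not at hex
    refine Finset.sum_eq_zero fun v _ => ?_
    by_cases hv : v ∈ A
    · rw [restrict_apply_of_mem hv]
      by_cases hH : starMatrix L r v = 0
      · rw [hH, zero_mul]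
      · rw [hex v hv hH, mul_zero]
    · rw [restrict_apply_of_not_mem hv, mul_zero]

/-! ### A connected, non-bounding, closed piece of a non-bounding cycle -/

/-- **Connected non-trivial piece** (port of `MinWeightDecodingClusters.exists_connected_piece` to
the torus-indexed chains): a cycle that is not a boundary contains a `checkGraph`-connected set of
links `A` on which it restricts to a cycle that is still not a boundary (split along cuts; boundaries
form a subspace; induct on the support). [cite: Gottesman2014, Thm 3 (proof: some cluster S with G|_S not in the stabilizer)] -/
theorem exists_connected_piece [NeZero L] {z : Chain L} (hz : z ∈ cycles L) (hzb : z ∉ boundaries L) :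
    ∃ A : Finset (Edge L), A ⊆ supp z ∧ A.Nonempty ∧ IsGraphConnected (checkGraph (starMatrix L)) A ∧
      Chain.restrict A z ∈ cycles L ∧ Chain.restrict A z ∉ boundaries L := by
  classical
  suffices hmain : ∀ k : ℕ, ∀ z : Chain L, (supp z).card = k → z ∈ cycles L → z ∉ boundaries L →
      ∃ A : Finset (Edge L), A ⊆ supp z ∧ A.Nonempty ∧ IsGraphConnected (checkGraph (starMatrix L)) A ∧
        Chain.restrict A z ∈ cycles L ∧ Chain.restrict A z ∉ boundaries L from hmain _ z rfl hz hzb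
  intro k
  induction k using Nat.strong_induction_on with
  | _ k ih =>
    intro z hk hz hzb
    have hzb' : z ∉ rowSpace (plaquetteMatrix L) := hzb
    have hne : (supp z).Nonempty := by
      rw [Finset.nonempty_iff_ne_empty]
      intro h
      apply hzb'
      have : z = 0 := by
        funext ℓ
        have hℓ : ℓ ∉ supp z := by rw [h]; exact Finset.notMem_empty ℓ
        simpa [supp] using hℓ
      rw [this]
      exact (rowSpace (plaquetteMatrix L)).zero_mem
    by_cases hconn : IsGraphConnected (checkGraph (starMatrix L)) (supp z)
    · exact ⟨supp z, Finset.Subset.refl _, hne, hconn, by rw [restrict_supp_self]; exact hz,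
        by rw [restrict_supp_self]; exact hzb⟩
    · unfold IsGraphConnected at hconn
      push Not at hconn
      obtain ⟨A, hAsub, hAne, hBne, hcut⟩ := hconn
      have hz0 : syn L z = 0 := hz
      -- both halves are cycles
      have hzA : syn L (Chain.restrict A z) = 0 :=
        syn_restrict_eq_zero hz0 fun a ha _ b hb => hcut a ha b hb
      have hzB : syn L (Chain.restrict Aᶜ z) = 0 := by
        refine syn_restrict_eq_zero hz0 fun a ha hza b hb hadj => ?_
        have ha' : a ∉ A := Finset.mem_compl.1 ha
        have hb' : b ∈ A := by
          have := (Finset.mem_sdiff.1 hb).2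
          rwa [Finset.mem_compl, not_not] at this
        have haz : a ∈ supp z \ A := Finset.mem_sdiff.2 ⟨by simpa [supp] using hza, ha'⟩
        exact hcut b hb' a haz hadj.symm
      -- one half is not a boundary (boundaries form a subspace)
      have hsplit : Chain.restrict A z ∉ boundaries L ∨ Chain.restrict Aᶜ z ∉ boundaries L := by
        by_contra h
        push Not at h
        have h1 : Chain.restrict A z ∈ rowSpace (plaquetteMatrix L) := h.1
        have h2 : Chain.restrict Aᶜ z ∈ rowSpace (plaquetteMatrix L) := h.2
        apply hzb'
        rw [← restrict_add_restrict_compl A z]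
        exact (rowSpace (plaquetteMatrix L)).add_mem h1 h2
      -- sizes drop
      have hsuppA : supp (Chain.restrict A z) = A := supp_restrict_of_subset hAsub
      have hsuppB : supp (Chain.restrict Aᶜ z) = supp z \ A := supp_restrict_compl z A
      have hcardA : (supp (Chain.restrict A z)).card < k := by
        rw [hsuppA, ← hk]
        refine Finset.card_lt_card ⟨hAsub, fun h => ?_⟩
        obtain ⟨b, hb⟩ := hBne
        exact (Finset.mem_sdiff.1 hb).2 (h (Finset.mem_sdiff.1 hb).1)
      have hcardB : (supp (Chain.restrict Aᶜ z)).card < k := by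
        rw [hsuppB, ← hk]
        refine Finset.card_lt_card ⟨Finset.sdiff_subset, fun h => ?_⟩
        obtain ⟨a, ha⟩ := hAne
        exact (Finset.mem_sdiff.1 (h (hAsub ha))).2 ha
      rcases hsplit with hA' | hB'
      · obtain ⟨A', hA'sub, hA'ne, hA'conn, hA'z, hA'b⟩ :=
          ih _ hcardA (Chain.restrict A z) rfl hzA hA'
        rw [hsuppA] at hA'sub
        rw [restrict_restrict_of_subset z hA'sub] at hA'z hA'b
        exact ⟨A', hA'sub.trans hAsub, hA'ne, hA'conn, hA'z, hA'b⟩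
      · obtain ⟨B', hB'sub, hB'ne, hB'conn, hB'z, hB'b⟩ :=
          ih _ hcardB (Chain.restrict Aᶜ z) rfl hzB hB'
        rw [hsuppB] at hB'sub
        have hB'c : B' ⊆ Aᶜ := fun ℓ hℓ => Finset.mem_compl.2 (Finset.mem_sdiff.1 (hB'sub hℓ)).2
        rw [restrict_restrict_of_subset z hB'c] at hB'z hB'b
        exact ⟨B', hB'sub.trans Finset.sdiff_subset, hB'ne, hB'conn, hB'z, hB'b⟩

/-! ### The toric check graph has degree at most `6` -/

/-- A star row vanishes at every link that is not one of its four slots.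
[cite: DennisEtAl2002, §3.1 (X_s acts on the four links meeting s)] -/
theorem starMatrix_eq_zero_of_not_mem [NeZero L] (s : Vertex L) (ℓ : Edge L)
    (h : ℓ ∉ ({(s, 0), (s, 1), (s - dir 0, 0), (s - dir 1, 1)} : Finset (Edge L))) :
    starMatrix L s ℓ = 0 := by
  simp only [Finset.mem_insert, Finset.mem_singleton, not_or] at h
  obtain ⟨h1, h2, h3, h4⟩ := h
  simp only [starMatrix, of_apply, starRow, Pi.add_apply, Pi.single_apply, if_neg h1, if_neg h2,
    if_neg h3, if_neg h4, add_zero]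

/-- A star row vanishes at the link `(v, i)` unless the star sits at `v` or at `v + eᵢ`.
[cite: DennisEtAl2002, §3.1 (each link meets two sites)] -/
theorem starMatrix_eq_zero_of_ne [NeZero L] (s : Vertex L) (ℓ : Edge L) (h1 : s ≠ ℓ.1)
    (h2 : s ≠ ℓ.1 + dir ℓ.2) : starMatrix L s ℓ = 0 := by
  apply starMatrix_eq_zero_of_not_mem
  obtain ⟨v, i⟩ := ℓ
  simp only at h1 h2
  simp only [Finset.mem_insert, Finset.mem_singleton, Prod.mk.injEq, not_or]
  refine ⟨fun h => h1 h.1.symm, fun h => h1 h.1.symm, fun h => h2 ?_, fun h => h2 ?_⟩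
  · rw [h.1, h.2]; simp
  · rw [h.1, h.2]; simp

/-- Every star row has at most `4` non-zero entries (row weight `≤ 4`).
[cite: DennisEtAl2002, §3.1 (X_s = ⊗ of four X's)] -/
theorem card_row_starMatrix_le [NeZero L] (s : Vertex L) :
    (univ.filter fun ℓ => starMatrix L s ℓ ≠ 0).card ≤ 4 := by
  classical
  have hsub : (univ.filter fun ℓ => starMatrix L s ℓ ≠ 0) ⊆
      ({(s, 0), (s, 1), (s - dir 0, 0), (s - dir 1, 1)} : Finset (Edge L)) := by
    intro ℓ hℓ
    rw [Finset.mem_filter] at hℓ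
    by_contra h
    exact hℓ.2 (starMatrix_eq_zero_of_not_mem s ℓ h)
  refine (Finset.card_le_card hsub).trans ?_
  refine (Finset.card_insert_le _ _).trans ?_
  refine (Nat.add_le_add_right (Finset.card_insert_le _ _) 1).trans ?_
  refine (Nat.add_le_add_right (Nat.add_le_add_right (Finset.card_insert_le _ _) 1) 1).trans ?_
  simp

/-- Every link lies in at most `2` stars (column weight `≤ 2`).
[cite: DennisEtAl2002, §3.1 (each link meets two sites)] -/
theorem card_col_starMatrix_le [NeZero L] (ℓ : Edge L) :
    (univ.filter fun s => starMatrix L s ℓ ≠ 0).card ≤ 2 := by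
  classical
  have hsub : (univ.filter fun s => starMatrix L s ℓ ≠ 0) ⊆ ({ℓ.1, ℓ.1 + dir ℓ.2} : Finset (Vertex L)) := by
    intro s hs
    rw [Finset.mem_filter] at hs
    by_contra h
    simp only [Finset.mem_insert, Finset.mem_singleton, not_or] at h
    exact hs.2 (starMatrix_eq_zero_of_ne s ℓ h.1 h.2)
  exact (Finset.card_le_card hsub).trans ((Finset.card_insert_le _ _).trans (by simp))

/-- **The toric check graph has maximal degree `≤ 6`** (`c(w-1)` with row weight `w = 4`, column
weight `c = 2`). [cite: Gottesman2014, §4 (degree z = (r-1)c)] -/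
theorem degree_starGraph_le [NeZero L] [DecidableRel (checkGraph (starMatrix L)).Adj] (ℓ : Edge L) :
    (checkGraph (starMatrix L)).degree ℓ ≤ 6 := by
  have := degree_checkGraph_le (starMatrix L) (w := 4) (c := 2) (card_row_starMatrix_le)
    (card_col_starMatrix_le) ℓ
  simpa using this

end ToricCluster

end Summit.Ventures.QEC.Thresholds

end
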